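import Mathlib.MeasureTheory.Measure.Lebesgue.EqHaar
import Mathlib.MeasureTheory.Function.EssSup
import Mathlib.MeasureTheory.Group.Prod
import Mathlib.Topology.Instances.EReal.Lemmas
import HarnessLib

/-!
# Almost convex functions (M. Kuczma 1970; Kuczma 2009, § 17.8) for the ideals of null sets

A function `f : E → ℝ` on a finite-dimensional real normed space `E` with an additive Haar measure `μ` is *almost
J-convex* if Jensen's inequality `f(½(x + y)) ≤ ½[f(x) + f(y)]` holds for `(μ ⊗ μ)`-almost every pair `(x, y)`.
Kuczma's theorem [Kuczma2009, Theorem 17.8.2] (Kuczma 2009 attributes Theorems 17.8.1–17.8.2 to 'Kuczma [178]' =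
[Kuczma1970]): such an `f` is `μ`-almost everywhere equal to a UNIQUE function `F : E → ℝ` that is J-convex at EVERY
pair.  This is the convexity companion of de Bruijn's theorem on almost additive functions (`AlmostAdditive.lean`) and
of Ger's theorem on almost subadditive functions (`AlmostSubadditive.lean`).

We follow the printed proof (Kuczma 2009, Lemmas 17.8.2–17.8.9, Corollary 17.8.1, Theorem 17.8.2) in the special case
`D = E`, `𝔍₁ = μ`-null sets, `𝔍₂ = (μ ⊗ μ)`-null sets (conjugate p.l.i. σ-ideals fulfilling (i), (ii) of § 17.8):
* `midEnvelope f μ x = ess inf_h ½[f(x + h) + f(x − h)]` — the envelope (17.8.27), valued in `EReal`;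
* `le_midEnvelope_ae`, `midEnvelope_le_ae`, `midEnvelope_ae_eq` — Lemma 17.8.8 (`f = g` a.e.): the sections of the
  exceptional set are null after the linear changes of variables of Lemmas 17.8.2–17.8.3 (`ae_ae_midpoint_right`,
  the shear `(x, h) ↦ (x + h, x − h)`), then the dyadic argument (17.8.31)–(17.8.32);
* `ae_pair_midconvex_midEnvelope` — Lemma 17.8.9; `midEnvelope_midconvex` — Lemma 17.8.7 (J-convexity of `g` at
  every pair); `midEnvelope_ne_bot` — finiteness of `g`; `midEnvelope_congr_ae`, `midEnvelope_eq_of_midconvex`,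
  `eq_of_midconvex_of_ae_eq` — Lemmas 17.8.5, 17.8.6 and Corollary 17.8.1 (uniqueness);
* `existsUnique_midconvex_ae_eq` — Theorem 17.8.2; `ae_pair_midconvex_of_ae_eq` — Theorem 17.8.1 (the converse).

Design: Jensen convexity of a real function is written `F ((2 : ℝ)⁻¹ • (x + y)) ≤ (F x + F y) / 2`; inequalities for
the `EReal`-valued envelope `g` are stated in the doubled form `g z + g z ≤ g x + g y` (no halving in `EReal`).

Deliberately NOT here (`TODO(general form)`): a convex open proper subset `D ⊊ E` as the domain; abstract conjugate
p.l.i. σ-ideals (e.g. the sets of first category, § 17.5); the continuity consequences of Chapter 9 are not drawn.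

## References
* [Kuczma2009] M. Kuczma, *An Introduction to the Theory of Functional Equations and Inequalities. Cauchy's Equation
  and Jensen's Inequality*, 2nd ed. (A. Gilányi, ed.), Birkhäuser, 2009 — § 17.8, Lemmas 17.8.1–17.8.9,
  Corollary 17.8.1, Theorems 17.8.1–17.8.2.
* [Kuczma1970] M. Kuczma, Almost convex functions, Colloq. Math. 21 (1970), 279–284 (reference [178] of [Kuczma2009]).
-/

noncomputable section

open MeasureTheory Filter Set Measure
open scoped ENNReal

namespace Literature.Analysis.FunctionalEquations.Kuczma1970

variable {E : Type*} [NormedAddCommGroup E] [NormedSpace ℝ E] [MeasurableSpace E] [BorelSpace E]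
  [FiniteDimensional ℝ E] (μ : Measure E) [μ.IsAddHaarMeasure]

/-! ### Null sets: the linear changes of variables of the printed proof -/

/-- The shear `(x, h) ↦ (x + h, x − h)` as a linear automorphism of `E × E` (inverse = Kuczma's `T`
(17.8.1) up to the factor `½`). [folklore] -/
def shear : (E × E) ≃ₗ[ℝ] (E × E) where
  toFun z := (z.1 + z.2, z.1 - z.2)
  invFun z := ((2 : ℝ)⁻¹ • (z.1 + z.2), (2 : ℝ)⁻¹ • (z.1 - z.2))
  map_add' z w := by ext <;> simp only [Prod.fst_add, Prod.snd_add, Prod.mk_add_mk] <;> abel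
  map_smul' c z := by ext <;> simp [smul_add, smul_sub]
  left_inv z := by
    ext <;> simp only
    · rw [show z.1 + z.2 + (z.1 - z.2) = (2 : ℝ) • z.1 by rw [two_smul]; abel, smul_smul]; norm_num
    · rw [show z.1 + z.2 - (z.1 - z.2) = (2 : ℝ) • z.2 by rw [two_smul]; abel, smul_smul]; norm_num
  right_inv z := by
    ext <;> simp only
    · rw [← smul_add, show z.1 + z.2 + (z.1 - z.2) = (2 : ℝ) • z.1 by rw [two_smul]; abel, smul_smul]; norm_num
    · rw [← smul_sub, show z.1 + z.2 - (z.1 - z.2) = (2 : ℝ) • z.2 by rw [two_smul]; abel, smul_smul]; norm_num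

/-- A linear automorphism of a finite-dimensional space is quasi-measure-preserving for an additive Haar measure.
[folklore] -/
private theorem quasiMeasurePreserving_linearEquiv {F : Type*} [NormedAddCommGroup F] [NormedSpace ℝ F]
    [MeasurableSpace F] [BorelSpace F] [FiniteDimensional ℝ F] (ν : Measure F) [ν.IsAddHaarMeasure]
    (L : F ≃ₗ[ℝ] F) : QuasiMeasurePreserving L ν ν := by
  refine ⟨L.toContinuousLinearEquiv.continuous.measurable, ?_⟩
  have hdet : LinearMap.det (L : F →ₗ[ℝ] F) ≠ 0 := by
    simpa using (LinearEquiv.isUnit_det' L).ne_zero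
  have := map_linearMap_addHaar_eq_smul_addHaar ν hdet
  rw [show ((L : F →ₗ[ℝ] F) : F → F) = L from rfl] at this
  rw [this]
  exact smul_absolutelyContinuous

/-- `(x, h) ↦ (x + h, x − h)` is quasi-measure-preserving for `μ ⊗ μ` — condition (ii) of § 17.8 (invariance of
`𝔍₂` under `T(x, y) = (½(x + y), ½(x − y))`, (17.8.1)) for the null sets of `μ ⊗ μ`. [folklore] -/
private theorem quasiMeasurePreserving_shear :
    QuasiMeasurePreserving (fun z : E × E => (z.1 + z.2, z.1 - z.2)) (μ.prod μ) (μ.prod μ) :=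
  quasiMeasurePreserving_linearEquiv (μ.prod μ) (shear (E := E))


/-! ### The midpoint essential envelope (17.8.27) -/

/-- Kuczma's envelope `g(x) = 𝔍₁-inf ess_h ½[f(x + h) + f(x − h)]` ((17.8.27) with `D = D_x = E` and `𝔍₁` the
`μ`-null sets), valued in `EReal` (the printed `g` takes values in `[−∞, ∞)`). [cite: Kuczma2009, § 17.8, (17.8.27)] -/
def midEnvelope (f : E → ℝ) (μ : Measure E) (x : E) : EReal :=
  essInf (fun h => (((f (x + h) + f (x - h)) / 2 : ℝ) : EReal)) μ

variable (f : E → ℝ)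

/-- The essential infimum of a real-valued function over a nonzero measure is never `+∞`. [folklore] -/
private theorem essInf_coe_ne_top' {α : Type*} [MeasurableSpace α] (ν : Measure α) [NeZero ν] (a : α → ℝ) :
    essInf (fun s => ((a s : ℝ) : EReal)) ν ≠ ⊤ := by
  intro h
  have hlt : ∀ n : ℕ, ∀ᵐ k ∂ν, (((n : ℝ) : ℝ) : EReal) < ((a k : ℝ) : EReal) := fun n => by
    have hn : (((n : ℝ) : ℝ) : EReal) < essInf (fun s => ((a s : ℝ) : EReal)) ν := by
      rw [h]; exact EReal.coe_lt_top _
    exact eventually_lt_of_lt_liminf hn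
  rw [← ae_all_iff] at hlt
  obtain ⟨k, hk⟩ := hlt.exists
  obtain ⟨n, hn⟩ := exists_nat_gt (a k)
  have := hk n
  rw [EReal.coe_lt_coe_iff] at this
  linarith

omit [NormedSpace ℝ E] [BorelSpace E] [FiniteDimensional ℝ E] in
/-- `g(x) < ∞` for every `x` ('Thus `g` is a function `g : D → [−∞, ∞)`', after (17.8.27)): the essential infimum of
a real-valued function over a nonzero measure is never `+∞`. [cite: Kuczma2009, § 17.8, (17.8.27)] -/
theorem midEnvelope_ne_top (x : E) : midEnvelope f μ x ≠ ⊤ :=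
  essInf_coe_ne_top' μ _

omit [MeasurableSpace E] [BorelSpace E] [FiniteDimensional ℝ E] in
/-- `½ (x + h + (x − h)) = x`. [folklore] -/
private theorem mid_add_sub (x h : E) : (2 : ℝ)⁻¹ • (x + h + (x - h)) = x := by
  rw [show x + h + (x - h) = (2 : ℝ) • x by rw [two_smul]; abel, smul_smul]; norm_num

omit [MeasurableSpace E] [BorelSpace E] [FiniteDimensional ℝ E] in
/-- `½ (x + (x + h)) = x + ½ h`. [folklore] -/
private theorem mid_add_add (x h : E) : (2 : ℝ)⁻¹ • (x + (x + h)) = x + (2 : ℝ)⁻¹ • h := by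
  rw [show x + (x + h) = (2 : ℝ) • x + h by rw [two_smul]; abel, smul_add, smul_smul]; norm_num

/-- **Lemma 17.8.8, first half** ((17.8.30)): an almost J-convex `f` satisfies `f ≤ g` almost everywhere; pull-back
of the a.e. hypothesis along the shear `(x, h) ↦ (x + h, x − h)` (Kuczma's Lemma 17.8.3: the sections `V_x` are null
for a.e. `x`), then Fubini. [cite: Kuczma2009, Lemma 17.8.8] -/
theorem le_midEnvelope_ae
    (hf : ∀ᵐ p ∂μ.prod μ, f ((2 : ℝ)⁻¹ • (p.1 + p.2)) ≤ (f p.1 + f p.2) / 2) :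
    ∀ᵐ x ∂μ, ((f x : ℝ) : EReal) ≤ midEnvelope f μ x := by
  have h1 : ∀ᵐ z ∂μ.prod μ, f ((2 : ℝ)⁻¹ • ((z.1 + z.2) + (z.1 - z.2))) ≤ (f (z.1 + z.2) + f (z.1 - z.2)) / 2 :=
    (quasiMeasurePreserving_shear μ).ae hf
  filter_upwards [Measure.ae_ae_of_ae_prod h1] with x hx
  refine le_essInf_of_ae_le _ (hx.mono fun h hh => ?_)
  rw [mid_add_sub] at hh
  exact EReal.coe_le_coe_iff.2 hh

/-- Kuczma's Lemma 17.8.2 in a.e. form: for almost every `x`, the midpoint inequality holds between `x` and almost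
every `x + h` (the sections `U_x` of the exceptional set are null). [cite: Kuczma2009, Lemma 17.8.2] -/
theorem ae_ae_midpoint_right
    (hf : ∀ᵐ p ∂μ.prod μ, f ((2 : ℝ)⁻¹ • (p.1 + p.2)) ≤ (f p.1 + f p.2) / 2) :
    ∀ᵐ x ∂μ, ∀ᵐ h ∂μ, f (x + (2 : ℝ)⁻¹ • h) ≤ (f x + f (x + h)) / 2 := by
  have h1 : ∀ᵐ z ∂μ.prod μ, f ((2 : ℝ)⁻¹ • (z.1 + (z.1 + z.2))) ≤ (f z.1 + f (z.1 + z.2)) / 2 :=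
    (measurePreserving_prod_add μ μ).quasiMeasurePreserving.ae hf
  filter_upwards [Measure.ae_ae_of_ae_prod h1] with x hx
  filter_upwards [hx] with h hh
  rwa [mid_add_add] at hh

/-- Dyadic descent: if `a (n+1) ≤ a n / 2` then `a n ≤ a 0 / 2 ^ n`. [folklore] -/
private theorem dyadic_descent {a : ℕ → ℝ} (h : ∀ n, a (n + 1) ≤ a n / 2) (n : ℕ) : a n ≤ a 0 / 2 ^ n := by
  induction n with
  | zero => simp
  | succ n ih =>
    calc a (n + 1) ≤ a n / 2 := h n
      _ ≤ (a 0 / 2 ^ n) / 2 := by linarith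
      _ = a 0 / 2 ^ (n + 1) := by rw [pow_succ]; ring

omit [MeasurableSpace E] [BorelSpace E] [FiniteDimensional ℝ E] in
/-- The dyadic step shared by Lemmas 17.8.6 and 17.8.8: if the midpoint inequality holds between `x` and
`x ± 2⁻ⁿh` for all `n`, then `aₙ = φ(x ± 2⁻ⁿh) − φ(x)` satisfies `aₙ₊₁ ≤ aₙ/2`, so `½[φ(x + 2⁻ⁿh) + φ(x − 2⁻ⁿh)]`
drops below any `c > φ(x)`. [folklore] -/
private theorem dyadic_below {φ : E → ℝ} {x h : E} {c : ℝ} (hc : φ x < c)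
    (hp : ∀ n : ℕ, φ (x + (2 : ℝ)⁻¹ • (((2 : ℝ)⁻¹) ^ n • h)) ≤ (φ x + φ (x + ((2 : ℝ)⁻¹) ^ n • h)) / 2)
    (hm : ∀ n : ℕ, φ (x + (2 : ℝ)⁻¹ • (-(((2 : ℝ)⁻¹) ^ n • h))) ≤ (φ x + φ (x + -(((2 : ℝ)⁻¹) ^ n • h))) / 2) :
    ∃ n : ℕ, (φ (x + ((2 : ℝ)⁻¹) ^ n • h) + φ (x - ((2 : ℝ)⁻¹) ^ n • h)) / 2 < c := by
  set a : ℕ → ℝ := fun n => φ (x + ((2 : ℝ)⁻¹) ^ n • h) - φ x with ha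
  set b : ℕ → ℝ := fun n => φ (x - ((2 : ℝ)⁻¹) ^ n • h) - φ x with hb
  have hstep : ∀ n, ((2 : ℝ)⁻¹) • (((2 : ℝ)⁻¹) ^ n • h) = ((2 : ℝ)⁻¹) ^ (n + 1) • h := fun n => by
    rw [smul_smul, ← pow_succ']
  have ha' : ∀ n, a (n + 1) ≤ a n / 2 := fun n => by
    have := hp n
    rw [hstep] at this
    simp only [ha]
    linarith
  have hb' : ∀ n, b (n + 1) ≤ b n / 2 := fun n => by
    have := hm n
    rw [smul_neg, hstep, ← sub_eq_add_neg, ← sub_eq_add_neg] at this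
    simp only [hb]
    linarith
  have hgap : 0 < c - φ x := by linarith
  obtain ⟨n, hn⟩ : ∃ n : ℕ, (a 0 + b 0) / 2 ^ n < c - φ x := by
    rcases le_or_gt (a 0 + b 0) 0 with hab | hab
    · exact ⟨0, by simp; linarith⟩
    · obtain ⟨n, hn⟩ := exists_pow_lt_of_lt_one (div_pos hgap hab) (by norm_num : ((2 : ℝ)⁻¹) < 1)
      refine ⟨n, ?_⟩
      rw [div_eq_inv_mul]
      rwa [inv_pow, lt_div_iff₀ hab] at hn
  have h1 := dyadic_descent ha' n
  have h2 := dyadic_descent hb' n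
  refine ⟨n, ?_⟩
  have : (φ (x + ((2 : ℝ)⁻¹) ^ n • h) + φ (x - ((2 : ℝ)⁻¹) ^ n • h)) / 2 = φ x + (a n + b n) / 2 := by
    simp only [ha, hb]; ring
  rw [this]
  have h4 : a n + b n ≤ (a 0 + b 0) / 2 ^ n := by rw [add_div]; exact add_le_add h1 h2
  linarith

/-- **Lemma 17.8.8, second half** ((17.8.31)–(17.8.32)): an almost J-convex `f` satisfies `g ≤ f` almost everywhere.
Printed argument: off the null set `B_x = ⋃ₙ 2ⁿ(A ∪ U_x ∪ −U_x ∪ …)`, iterating the midpoint inequality between `x` and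
`x ± 2⁻ⁿ h` gives `f(x ± 2⁻⁽ⁿ⁺¹⁾h) − f(x) ≤ ½ [f(x ± 2⁻ⁿh) − f(x)]`, so `limsup ½[f(x + 2⁻ⁿh) + f(x − 2⁻ⁿh)] ≤ f(x)`
while `2⁻ⁿ h ∉ A`. [cite: Kuczma2009, Lemma 17.8.8] -/
theorem midEnvelope_le_ae
    (hf : ∀ᵐ p ∂μ.prod μ, f ((2 : ℝ)⁻¹ • (p.1 + p.2)) ≤ (f p.1 + f p.2) / 2) :
    ∀ᵐ x ∂μ, midEnvelope f μ x ≤ ((f x : ℝ) : EReal) := by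
  have hU := ae_ae_midpoint_right μ f hf
  -- the same towards `x − h` (negation is quasi-measure-preserving)
  have hU' : ∀ᵐ x ∂μ, ∀ᵐ h ∂μ, f (x + (2 : ℝ)⁻¹ • (-h)) ≤ (f x + f (x + -h)) / 2 := by
    filter_upwards [hU] with x hx
    exact (quasiMeasurePreserving_neg μ).ae hx
  filter_upwards [hU, hU'] with x hx hx'
  refine not_lt.1 fun hlt => ?_
  -- a real level strictly between `f x` and `g x`; the sublevel set `A` of the integrand below it is null
  obtain ⟨c, hc1, hc2⟩ := EReal.exists_between_coe_real hlt
  have hA : ∀ᵐ k ∂μ, ((c : ℝ) : EReal) < (((f (x + k) + f (x - k)) / 2 : ℝ) : EReal) := eventually_lt_of_lt_liminf hc2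
  -- along the dyadic sequence `2⁻ⁿ h` everything holds for a.e. `h` (scalings preserve null sets)
  have hdy : ∀ᵐ h ∂μ, ∀ n : ℕ,
      (c < (f (x + ((2 : ℝ)⁻¹) ^ n • h) + f (x - ((2 : ℝ)⁻¹) ^ n • h)) / 2) ∧
      (f (x + (2 : ℝ)⁻¹ • (((2 : ℝ)⁻¹) ^ n • h)) ≤ (f x + f (x + ((2 : ℝ)⁻¹) ^ n • h)) / 2) ∧
      (f (x + (2 : ℝ)⁻¹ • (-(((2 : ℝ)⁻¹) ^ n • h))) ≤ (f x + f (x + -(((2 : ℝ)⁻¹) ^ n • h))) / 2) := by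
    rw [ae_all_iff]
    intro n
    have hc : ((2 : ℝ)⁻¹) ^ n ≠ 0 := pow_ne_zero _ (by norm_num)
    have q := quasiMeasurePreserving_smul μ hc
    filter_upwards [q.ae hA, q.ae hx, q.ae hx'] with h h1 h2 h3
    exact ⟨EReal.coe_lt_coe_iff.1 h1, h2, h3⟩
  obtain ⟨h, hh⟩ := hdy.exists
  obtain ⟨n, hn⟩ := dyadic_below (EReal.coe_lt_coe_iff.1 hc1) (fun n => (hh n).2.1) fun n => (hh n).2.2
  exact absurd (hh n).1 (not_lt.2 hn.le)

/-- **Lemma 17.8.8**: `f = g` almost everywhere. [cite: Kuczma2009, Lemma 17.8.8] -/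
theorem midEnvelope_ae_eq
    (hf : ∀ᵐ p ∂μ.prod μ, f ((2 : ℝ)⁻¹ • (p.1 + p.2)) ≤ (f p.1 + f p.2) / 2) :
    ∀ᵐ x ∂μ, midEnvelope f μ x = ((f x : ℝ) : EReal) := by
  filter_upwards [le_midEnvelope_ae μ f hf, midEnvelope_le_ae μ f hf] with x h1 h2
  exact le_antisymm h2 h1

/-- The a.e. equality `g = f` transported to `x + h` and `x − h` (translations and reflections preserve null sets).
[folklore] -/
private theorem ae_eq_shift
    (hf : ∀ᵐ p ∂μ.prod μ, f ((2 : ℝ)⁻¹ • (p.1 + p.2)) ≤ (f p.1 + f p.2) / 2) (x : E) :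
    ∀ᵐ h ∂μ, midEnvelope f μ (x + h) = ((f (x + h) : ℝ) : EReal) ∧
      midEnvelope f μ (x - h) = ((f (x - h) : ℝ) : EReal) :=
  ((measurePreserving_add_left μ x).quasiMeasurePreserving.ae (midEnvelope_ae_eq μ f hf)).and
    ((quasiMeasurePreserving_sub_left μ x).ae (midEnvelope_ae_eq μ f hf))

/-- (17.8.16) for `g`, doubled form: for EVERY `x` and almost every `h`, `2 g(x) ≤ g(x + h) + g(x − h)`
(by Lemmas 17.8.5 and 17.8.8 the envelope of `f` is the envelope of `g`). [cite: Kuczma2009, Lemma 17.8.7, (17.8.16)] -/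
theorem midEnvelope_add_self_le_ae
    (hf : ∀ᵐ p ∂μ.prod μ, f ((2 : ℝ)⁻¹ • (p.1 + p.2)) ≤ (f p.1 + f p.2) / 2) (x : E) :
    ∀ᵐ h ∂μ, midEnvelope f μ x + midEnvelope f μ x ≤ midEnvelope f μ (x + h) + midEnvelope f μ (x - h) := by
  have h1 : ∀ᵐ h ∂μ, midEnvelope f μ x ≤ (((f (x + h) + f (x - h)) / 2 : ℝ) : EReal) := ae_essInf_le
  filter_upwards [h1, ae_eq_shift μ f hf x] with h hh he
  rw [he.1, he.2, ← EReal.coe_add]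
  calc midEnvelope f μ x + midEnvelope f μ x
      ≤ (((f (x + h) + f (x - h)) / 2 : ℝ) : EReal) + (((f (x + h) + f (x - h)) / 2 : ℝ) : EReal) :=
        add_le_add hh hh
    _ = ((f (x + h) + f (x - h) : ℝ) : EReal) := by rw [← EReal.coe_add]; congr 1; ring

/-- `½ (p₁ + p₂)` is quasi-measure-preserving from `μ ⊗ μ` to `μ`. [folklore] -/
private theorem quasiMeasurePreserving_midpoint :
    QuasiMeasurePreserving (fun p : E × E => (2 : ℝ)⁻¹ • (p.1 + p.2)) (μ.prod μ) μ :=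
  (quasiMeasurePreserving_smul μ (by norm_num : (2 : ℝ)⁻¹ ≠ 0)).comp (quasiMeasurePreserving_add μ μ)

/-- **Lemma 17.8.9** (doubled form): `g` is J-convex on almost every pair. [cite: Kuczma2009, Lemma 17.8.9] -/
theorem ae_pair_midconvex_midEnvelope
    (hf : ∀ᵐ p ∂μ.prod μ, f ((2 : ℝ)⁻¹ • (p.1 + p.2)) ≤ (f p.1 + f p.2) / 2) :
    ∀ᵐ p ∂μ.prod μ, midEnvelope f μ ((2 : ℝ)⁻¹ • (p.1 + p.2)) + midEnvelope f μ ((2 : ℝ)⁻¹ • (p.1 + p.2)) ≤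
      midEnvelope f μ p.1 + midEnvelope f μ p.2 := by
  have e0 := midEnvelope_ae_eq μ f hf
  have e1 : ∀ᵐ p ∂μ.prod μ, midEnvelope f μ p.1 = ((f p.1 : ℝ) : EReal) := quasiMeasurePreserving_fst.ae e0
  have e2 : ∀ᵐ p ∂μ.prod μ, midEnvelope f μ p.2 = ((f p.2 : ℝ) : EReal) := quasiMeasurePreserving_snd.ae e0
  have e3 : ∀ᵐ p ∂μ.prod μ, midEnvelope f μ ((2 : ℝ)⁻¹ • (p.1 + p.2)) = ((f ((2 : ℝ)⁻¹ • (p.1 + p.2)) : ℝ) : EReal) :=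
    (quasiMeasurePreserving_midpoint μ).ae e0
  filter_upwards [hf, e1, e2, e3] with p hp h1 h2 h3
  rw [h1, h2, h3, ← EReal.coe_add, ← EReal.coe_add, EReal.coe_le_coe_iff]
  linarith


omit [MeasurableSpace E] [BorelSpace E] [FiniteDimensional ℝ E] in
/-- `½((x + h) + (y + k)) = ½(x + y) + ½(h + k)`. [folklore] -/
private theorem mid_add_add_add (x y h k : E) :
    (2 : ℝ)⁻¹ • ((x + h) + (y + k)) = (2 : ℝ)⁻¹ • (x + y) + (2 : ℝ)⁻¹ • (h + k) := by
  rw [← smul_add]; congr 1; abel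

omit [MeasurableSpace E] [BorelSpace E] [FiniteDimensional ℝ E] in
/-- `½((x − h) + (y − k)) = ½(x + y) − ½(h + k)`. [folklore] -/
private theorem mid_sub_add_sub (x y h k : E) :
    (2 : ℝ)⁻¹ • ((x - h) + (y - k)) = (2 : ℝ)⁻¹ • (x + y) - (2 : ℝ)⁻¹ • (h + k) := by
  rw [← smul_sub]; congr 1; abel

/-- The `EReal` bookkeeping at the end of the proof of Lemma 17.8.7: from `2c ≤ P + Q`, `2P ≤ p`, `2Q ≤ q` (all but
`c, p, q` possibly infinite) conclude `4c ≤ p + q`. [folklore] -/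
private theorem ereal_chain {c p q : ℝ} {P Q : EReal} (h0 : ((c : ℝ) : EReal) + c ≤ P + Q)
    (hP : P + P ≤ ((p : ℝ) : EReal)) (hQ : Q + Q ≤ ((q : ℝ) : EReal)) : 4 * c ≤ p + q := by
  have hPt : P ≠ ⊤ := by
    rintro rfl; rw [EReal.top_add_top] at hP; exact absurd hP (not_le.2 (EReal.coe_lt_top p))
  have hQt : Q ≠ ⊤ := by
    rintro rfl; rw [EReal.top_add_top] at hQ; exact absurd hQ (not_le.2 (EReal.coe_lt_top q))
  have hcc : ((c : ℝ) : EReal) + c = ((c + c : ℝ) : EReal) := (EReal.coe_add c c).symm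
  have hPb : P ≠ ⊥ := by
    rintro rfl; rw [EReal.bot_add, hcc] at h0; exact absurd h0 (not_le.2 (EReal.bot_lt_coe _))
  have hQb : Q ≠ ⊥ := by
    rintro rfl; rw [EReal.add_bot, hcc] at h0; exact absurd h0 (not_le.2 (EReal.bot_lt_coe _))
  obtain ⟨p', rfl⟩ : ∃ p' : ℝ, (p' : EReal) = P := ⟨P.toReal, EReal.coe_toReal hPt hPb⟩
  obtain ⟨q', rfl⟩ : ∃ q' : ℝ, (q' : EReal) = Q := ⟨Q.toReal, EReal.coe_toReal hQt hQb⟩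
  rw [← EReal.coe_add, ← EReal.coe_add, EReal.coe_le_coe_iff] at h0
  rw [← EReal.coe_add, EReal.coe_le_coe_iff] at hP hQ
  linarith

/-- **Lemma 17.8.7** (doubled form): the envelope `g` of an almost J-convex function is J-convex at EVERY pair,
`2 g(½(x + y)) ≤ g(x) + g(y)`.  Printed proof: `B_x = {h : ½[g(x+h) + g(x−h)] < a}` is not null for `a > g(x)`; choose
`h′ ∈ B_x` with `x ± h′` generic, then `h″ ∈ B_y` off three null sets, and chain (17.8.22)–(17.8.26).
[cite: Kuczma2009, Lemma 17.8.7] -/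
theorem midEnvelope_midconvex
    (hf : ∀ᵐ p ∂μ.prod μ, f ((2 : ℝ)⁻¹ • (p.1 + p.2)) ≤ (f p.1 + f p.2) / 2) (x y : E) :
    midEnvelope f μ ((2 : ℝ)⁻¹ • (x + y)) + midEnvelope f μ ((2 : ℝ)⁻¹ • (x + y)) ≤
      midEnvelope f μ x + midEnvelope f μ y := by
  set g := midEnvelope f μ with hg
  set z := (2 : ℝ)⁻¹ • (x + y) with hz
  -- `U` is null: for a.e. `w`, the pair `(w, v)` is non-exceptional for a.e. `v`
  have hU : ∀ᵐ w ∂μ, ∀ᵐ v ∂μ, g ((2 : ℝ)⁻¹ • (w + v)) + g ((2 : ℝ)⁻¹ • (w + v)) ≤ g w + g v :=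
    Measure.ae_ae_of_ae_prod (ae_pair_midconvex_midEnvelope μ f hf)
  refine EReal.le_add_of_forall_gt (Or.inr (midEnvelope_ne_top μ f y)) (Or.inl (midEnvelope_ne_top μ f x))
    fun a ha b hb => ?_
  -- the bounds `a > g x`, `b > g y` may be taken real
  have hab : a ≠ ⊥ := ne_bot_of_gt ha
  have hbb : b ≠ ⊥ := ne_bot_of_gt hb
  rcases eq_or_ne a ⊤ with rfl | hat
  · rw [EReal.top_add_of_ne_bot hbb]; exact le_top
  rcases eq_or_ne b ⊤ with rfl | hbt
  · rw [EReal.add_top_of_ne_bot hab]; exact le_top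
  obtain ⟨α, rfl⟩ : ∃ α : ℝ, (α : EReal) = a := ⟨a.toReal, EReal.coe_toReal hat hab⟩
  obtain ⟨β, rfl⟩ : ∃ β : ℝ, (β : EReal) = b := ⟨b.toReal, EReal.coe_toReal hbt hbb⟩
  -- STEP 1: `h′ ∈ B_x` with `g = f` at `x ± h′` and `x ± h′ ∉ U`
  have F1 : ∃ᶠ h in ae μ, (((f (x + h) + f (x - h)) / 2 : ℝ) : EReal) < (α : EReal) :=
    frequently_lt_of_liminf_lt (by isBoundedDefault) ha
  have E1 := ae_eq_shift μ f hf x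
  have E2 : ∀ᵐ h ∂μ, (∀ᵐ v ∂μ, g ((2 : ℝ)⁻¹ • ((x - h) + v)) + g ((2 : ℝ)⁻¹ • ((x - h) + v)) ≤ g (x - h) + g v) ∧
      (∀ᵐ v ∂μ, g ((2 : ℝ)⁻¹ • ((x + h) + v)) + g ((2 : ℝ)⁻¹ • ((x + h) + v)) ≤ g (x + h) + g v) :=
    ((quasiMeasurePreserving_sub_left μ x).ae hU).and ((measurePreserving_add_left μ x).quasiMeasurePreserving.ae hU)
  obtain ⟨h', hB1, ⟨hgx1, hgx2⟩, hUm, hUp⟩ := (F1.and_eventually (E1.and E2)).exists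
  -- STEP 2: `h″ ∈ B_y` with `g = f` at `y ± h″`, both pairs `(x ∓ h′, y ∓ h″)` non-exceptional, and `½(h′ + h″)`
  -- admissible for (17.8.16) at `z`
  have F2 : ∃ᶠ k in ae μ, (((f (y + k) + f (y - k)) / 2 : ℝ) : EReal) < (β : EReal) :=
    frequently_lt_of_liminf_lt (by isBoundedDefault) hb
  have E3 := ae_eq_shift μ f hf y
  have E4 : ∀ᵐ k ∂μ,
      g ((2 : ℝ)⁻¹ • ((x - h') + (y - k))) + g ((2 : ℝ)⁻¹ • ((x - h') + (y - k))) ≤ g (x - h') + g (y - k) :=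
    (quasiMeasurePreserving_sub_left μ y).ae hUm
  have E5 : ∀ᵐ k ∂μ,
      g ((2 : ℝ)⁻¹ • ((x + h') + (y + k))) + g ((2 : ℝ)⁻¹ • ((x + h') + (y + k))) ≤ g (x + h') + g (y + k) :=
    (measurePreserving_add_left μ y).quasiMeasurePreserving.ae hUp
  have E6 : ∀ᵐ k ∂μ, g z + g z ≤ g (z + (2 : ℝ)⁻¹ • (h' + k)) + g (z - (2 : ℝ)⁻¹ • (h' + k)) :=
    ((quasiMeasurePreserving_smul μ (by norm_num : (2 : ℝ)⁻¹ ≠ 0)).comp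
      (measurePreserving_add_left μ h').quasiMeasurePreserving).ae (midEnvelope_add_self_le_ae μ f hf z)
  obtain ⟨h'', hB2, ⟨hgy1, hgy2⟩, hJm, hJp, hz16⟩ := (F2.and_eventually (E3.and (E4.and (E5.and E6)))).exists
  -- STEP 3: the chain (17.8.22)–(17.8.26)
  rw [mid_sub_add_sub] at hJm
  rw [mid_add_add_add] at hJp
  rw [← hz] at hJm hJp
  rw [← hg] at hgx1 hgx2 hgy1 hgy2
  rw [hgx1, hgy1] at hJp
  rw [hgx2, hgy2] at hJm
  rw [← EReal.coe_add] at hJp hJm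
  have hB1' : f (x + h') + f (x - h') < 2 * α := by
    have := EReal.coe_lt_coe_iff.1 hB1; linarith
  have hB2' : f (y + h'') + f (y - h'') < 2 * β := by
    have := EReal.coe_lt_coe_iff.1 hB2; linarith
  -- case `g z = ⊥`: trivial
  rcases eq_or_ne (g z) ⊥ with hbot | hzb
  · rw [hbot, EReal.bot_add]; exact bot_le
  obtain ⟨c, hc⟩ : ∃ c : ℝ, (c : EReal) = g z := ⟨(g z).toReal, EReal.coe_toReal (midEnvelope_ne_top μ f z) hzb⟩
  rw [← hc] at hz16 ⊢
  have key := ereal_chain hz16 hJp hJm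
  rw [← EReal.coe_add, ← EReal.coe_add, EReal.coe_le_coe_iff]
  linarith


/-! ### Uniqueness: Lemmas 17.8.5, 17.8.6 and Corollary 17.8.1 -/

/-- **Lemma 17.8.5** (for the envelope (17.8.27)): functions equal almost everywhere have the same envelope at
EVERY point (translations and the reflection preserve null sets). [cite: Kuczma2009, Lemma 17.8.5] -/
theorem midEnvelope_congr_ae {f₁ f₂ : E → ℝ} (h : ∀ᵐ x ∂μ, f₁ x = f₂ x) (x : E) :
    midEnvelope f₁ μ x = midEnvelope f₂ μ x := by
  apply essInf_congr_ae
  filter_upwards [(measurePreserving_add_left μ x).quasiMeasurePreserving.ae h,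
    (quasiMeasurePreserving_sub_left μ x).ae h] with k h1 h2
  simp only [h1, h2]

/-- **Lemma 17.8.6** ((17.8.12)): a J-convex `F : E → ℝ` equals its envelope (17.8.27) at EVERY point.  Printed
proof: `F(x) ≤ ½[F(x + h) + F(x − h)]` for all `h`, and `lim ½[F(x + 2⁻ⁿh) + F(x − 2⁻ⁿh)] = F(x)` along dyadic
sequences (Theorem 6.1.1) while the scalings `2ⁿA` of a null set stay null (condition (i)).
[cite: Kuczma2009, Lemma 17.8.6] -/
theorem midEnvelope_eq_of_midconvex {F : E → ℝ} (hF : ∀ x y, F ((2 : ℝ)⁻¹ • (x + y)) ≤ (F x + F y) / 2)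
    (x : E) : midEnvelope F μ x = ((F x : ℝ) : EReal) := by
  refine le_antisymm (not_lt.1 fun hlt => ?_) (le_essInf_of_ae_le _ (Eventually.of_forall fun h => ?_))
  · obtain ⟨c, hc1, hc2⟩ := EReal.exists_between_coe_real hlt
    have hA : ∀ᵐ k ∂μ, ((c : ℝ) : EReal) < (((F (x + k) + F (x - k)) / 2 : ℝ) : EReal) :=
      eventually_lt_of_lt_liminf hc2
    have hdy : ∀ᵐ h ∂μ, ∀ n : ℕ, c < (F (x + ((2 : ℝ)⁻¹) ^ n • h) + F (x - ((2 : ℝ)⁻¹) ^ n • h)) / 2 := by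
      rw [ae_all_iff]
      intro n
      filter_upwards [(quasiMeasurePreserving_smul μ (pow_ne_zero n (by norm_num : (2 : ℝ)⁻¹ ≠ 0))).ae hA]
        with h h1
      exact EReal.coe_lt_coe_iff.1 h1
    obtain ⟨h, hh⟩ := hdy.exists
    obtain ⟨n, hn⟩ := dyadic_below (φ := F) (h := h) (EReal.coe_lt_coe_iff.1 hc1)
      (fun n => by have := hF x (x + ((2 : ℝ)⁻¹) ^ n • h); rwa [mid_add_add] at this)
      (fun n => by have := hF x (x + -(((2 : ℝ)⁻¹) ^ n • h)); rwa [mid_add_add] at this)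
    exact absurd (hh n) (not_lt.2 hn.le)
  · have := hF (x + h) (x - h)
    rw [mid_add_sub] at this
    exact EReal.coe_le_coe_iff.2 this

/-- **Corollary 17.8.1**: two J-convex functions `E → ℝ` that agree almost everywhere agree everywhere.
[cite: Kuczma2009, Corollary 17.8.1] -/
theorem eq_of_midconvex_of_ae_eq {F₁ F₂ : E → ℝ} (h₁ : ∀ x y, F₁ ((2 : ℝ)⁻¹ • (x + y)) ≤ (F₁ x + F₁ y) / 2)
    (h₂ : ∀ x y, F₂ ((2 : ℝ)⁻¹ • (x + y)) ≤ (F₂ x + F₂ y) / 2) (h : ∀ᵐ x ∂μ, F₁ x = F₂ x) : F₁ = F₂ := by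
  funext x
  have e := midEnvelope_congr_ae μ h x
  rwa [midEnvelope_eq_of_midconvex μ h₁, midEnvelope_eq_of_midconvex μ h₂, EReal.coe_eq_coe_iff] at e

/-! ### Theorem 17.8.2 -/

/-- **Theorem 17.8.2, finiteness of `g`**: the envelope of an almost J-convex `f : E → ℝ` is finite everywhere.
Printed proof: take `y` with `(x, y) ∉ M` and `y, ½(x + y) ∉ U`; then `2g(½(x + y)) ≤ g(x) + g(y)` with
`g(y) = f(y)` and `g(½(x + y)) = f(½(x + y))` finite forces `g(x) ≠ −∞` (here via Lemma 17.8.7, valid at every pair).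
[cite: Kuczma2009, Theorem 17.8.2] -/
theorem midEnvelope_ne_bot
    (hf : ∀ᵐ p ∂μ.prod μ, f ((2 : ℝ)⁻¹ • (p.1 + p.2)) ≤ (f p.1 + f p.2) / 2) (x : E) :
    midEnvelope f μ x ≠ ⊥ := by
  have e0 := midEnvelope_ae_eq μ f hf
  have e1 : ∀ᵐ y ∂μ, midEnvelope f μ ((2 : ℝ)⁻¹ • (x + y)) = ((f ((2 : ℝ)⁻¹ • (x + y)) : ℝ) : EReal) :=
    ((quasiMeasurePreserving_smul μ (by norm_num : (2 : ℝ)⁻¹ ≠ 0)).comp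
      (measurePreserving_add_left μ x).quasiMeasurePreserving).ae e0
  obtain ⟨y, hy, hm⟩ := (e0.and e1).exists
  intro hbot
  have key := midEnvelope_midconvex μ f hf x y
  rw [hm, hy, hbot, EReal.bot_add, ← EReal.coe_add] at key
  exact absurd key (not_le.2 (EReal.bot_lt_coe _))

/-- The real-valued version of the envelope, `G = toReal ∘ g`: by `midEnvelope_ne_top` and `midEnvelope_ne_bot`
('thus `g` is finite') no information is lost. [cite: Kuczma2009, Theorem 17.8.2] -/
theorem coe_toReal_midEnvelope
    (hf : ∀ᵐ p ∂μ.prod μ, f ((2 : ℝ)⁻¹ • (p.1 + p.2)) ≤ (f p.1 + f p.2) / 2) (x : E) :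
    (((midEnvelope f μ x).toReal : ℝ) : EReal) = midEnvelope f μ x :=
  EReal.coe_toReal (midEnvelope_ne_top μ f x) (midEnvelope_ne_bot μ f hf x)

/-- **Theorem 17.8.2, convexity of `g`** (real-valued form): `G = toReal ∘ g` is J-convex at every pair.
[cite: Kuczma2009, Theorem 17.8.2] -/
theorem midconvex_toReal_midEnvelope
    (hf : ∀ᵐ p ∂μ.prod μ, f ((2 : ℝ)⁻¹ • (p.1 + p.2)) ≤ (f p.1 + f p.2) / 2) (x y : E) :
    (midEnvelope f μ ((2 : ℝ)⁻¹ • (x + y))).toReal ≤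
      ((midEnvelope f μ x).toReal + (midEnvelope f μ y).toReal) / 2 := by
  have h := midEnvelope_midconvex μ f hf x y
  rw [← coe_toReal_midEnvelope μ f hf ((2 : ℝ)⁻¹ • (x + y)), ← coe_toReal_midEnvelope μ f hf x,
    ← coe_toReal_midEnvelope μ f hf y, ← EReal.coe_add, ← EReal.coe_add, EReal.coe_le_coe_iff] at h
  linarith

/-- **Theorem 17.8.2, (17.8.6)** (real-valued form): `f = G` almost everywhere. [cite: Kuczma2009, Theorem 17.8.2] -/
theorem ae_eq_toReal_midEnvelope
    (hf : ∀ᵐ p ∂μ.prod μ, f ((2 : ℝ)⁻¹ • (p.1 + p.2)) ≤ (f p.1 + f p.2) / 2) :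
    ∀ᵐ x ∂μ, f x = (midEnvelope f μ x).toReal := by
  filter_upwards [midEnvelope_ae_eq μ f hf] with x hx
  rw [hx, EReal.toReal_coe]

/-- **Theorem 17.8.2** (M. Kuczma 1970) for the σ-ideals of null sets of an additive Haar measure on a
finite-dimensional real normed space `E` (Kuczma's `D = ℝᴺ`, `𝔍₁ = ` Lebesgue-null sets, `𝔍₂ = ` null sets of the
plane measure — conjugate p.l.i. σ-ideals with (i), (ii), Section 17.5): **if `f : E → ℝ` satisfies Jensen's inequality
`f(½(x + y)) ≤ ½[f(x) + f(y)]` for `(μ ⊗ μ)`-almost every pair `(x, y)`, then there is exactly one J-convex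
`F : E → ℝ` (Jensen's inequality at every pair) with `f = F` `μ`-almost everywhere**; `F = toReal ∘ midEnvelope f μ`.
[cite: Kuczma2009, Theorem 17.8.2] [cite: Kuczma1970, Theorem 2] -/
theorem existsUnique_midconvex_ae_eq
    (hf : ∀ᵐ p ∂μ.prod μ, f ((2 : ℝ)⁻¹ • (p.1 + p.2)) ≤ (f p.1 + f p.2) / 2) :
    ∃! F : E → ℝ, (∀ x y, F ((2 : ℝ)⁻¹ • (x + y)) ≤ (F x + F y) / 2) ∧ ∀ᵐ x ∂μ, f x = F x := by
  refine ⟨fun x => (midEnvelope f μ x).toReal,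
    ⟨midconvex_toReal_midEnvelope μ f hf, ae_eq_toReal_midEnvelope μ f hf⟩, fun F hF => ?_⟩
  refine eq_of_midconvex_of_ae_eq μ hF.1 (midconvex_toReal_midEnvelope μ f hf) ?_
  filter_upwards [hF.2, ae_eq_toReal_midEnvelope μ f hf] with x h1 h2
  rw [← h1, ← h2]

/-- **Theorem 17.8.1** (for the ideals of null sets): conversely, a function which agrees almost everywhere with a
J-convex function `F : E → ℝ` is almost J-convex. [cite: Kuczma2009, Theorem 17.8.1] -/
theorem ae_pair_midconvex_of_ae_eq {F : E → ℝ} (hF : ∀ x y, F ((2 : ℝ)⁻¹ • (x + y)) ≤ (F x + F y) / 2)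
    (h : ∀ᵐ x ∂μ, f x = F x) :
    ∀ᵐ p ∂μ.prod μ, f ((2 : ℝ)⁻¹ • (p.1 + p.2)) ≤ (f p.1 + f p.2) / 2 := by
  have h1 : ∀ᵐ p ∂μ.prod μ, f p.1 = F p.1 := quasiMeasurePreserving_fst.ae h
  have h2 : ∀ᵐ p ∂μ.prod μ, f p.2 = F p.2 := quasiMeasurePreserving_snd.ae h
  have h3 : ∀ᵐ p ∂μ.prod μ, f ((2 : ℝ)⁻¹ • (p.1 + p.2)) = F ((2 : ℝ)⁻¹ • (p.1 + p.2)) :=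
    (quasiMeasurePreserving_midpoint μ).ae h
  filter_upwards [h1, h2, h3] with p e1 e2 e3
  rw [e1, e2, e3]
  exact hF p.1 p.2

-- TODO(general form): Kuczma's Theorem 17.8.2 is printed for a convex open `D ⊆ ℝᴺ` and abstract conjugate
-- p.l.i. σ-ideals `𝔍₁, 𝔍₂` with (i), (ii) (e.g. the sets of first category); here `D = E` and the null ideals only.

end Literature.Analysis.FunctionalEquations.Kuczma1970
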